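import Mathlib.LinearAlgebra.Matrix.NonsingularInverse
import Mathlib.LinearAlgebra.Matrix.Determinant.Basic
import Mathlib.LinearAlgebra.Matrix.Rank
import Mathlib.LinearAlgebra.Matrix.Adjugate
import Mathlib.LinearAlgebra.Matrix.AbsoluteValue
import Mathlib.LinearAlgebra.Dimension.Constructions
import Mathlib.LinearAlgebra.LinearIndependent.Lemmas
import Mathlib.LinearAlgebra.FiniteDimensional.Lemmas
import Literature.Barriers.Schanuel.AlgebraicIndependenceOfLogarithmsRankProofs
import HarnessLib

/-!
# Integer solutions of solvable linear systems, with a height bound (support file for Ostrowski's theorem)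

Support file for the proof of Ostrowski's theorem
(`Literature.RingTheory.MvPolynomial.ostrowski1919_absIrreducible_reduction`, Schmidt, *Equations
over finite fields*, Ch. V, Cor. 2B) along the Nullstellensatz-certificate line: a Bézout identity
`∑ gᵣ δᵣ = 1` over `ℚ` is a solvable linear system with INTEGER coefficients, and we need an
integer solution of `M z = Γ b` with a non-zero integer `Γ` of controlled size, so that the
identity survives reduction modulo every prime `p ∤ Γ`.

## Contents (all [folklore] linear algebra)

* `exists_mulVec_eq_zero_of_rank_lt_card`, `exists_mulVec_eq_zero_of_forall_det_submatrix_eq_zero`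
  — over a field, a matrix all of whose column-full minors vanish has a non-zero kernel vector
  (rank through minors, reusing `Literature.Barriers.Schanuel.rank_le_of_det_submatrix_eq_zero`).
* `exists_int_mulVec_eq_smul` — **integer Cramer rule with a bound**: if `M ∈ ℤ^{ρ × κ}`,
  `b ∈ ℤ^ρ` have entries of absolute value `≤ A` (`A ≥ 1`) and `M y = b` is solvable over `ℚ`,
  then `M z = Γ b` for some `z ∈ ℤ^κ` and `Γ ∈ ℤ`, `0 < |Γ| ≤ (#κ)! A^{#κ}`. Proof: a solution of
  minimal support has linearly independent support columns; a non-zero maximal minor `Γ` of these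
  columns exists (rank through minors); Cramer's rule on that square block makes `Γ y` integral;
  the trivial bound `|det| ≤ t! A^t` (`Matrix.det_le`).

## References

* W. M. Schmidt, *Equations over finite fields. An elementary approach*, LNM 536 (1976), 2nd ed.
  (2004), Ch. V §2 (the linear system (2.2) and its minors). [`Schmidt1976`]
-/

noncomputable section

namespace Literature.RingTheory.MvPolynomial

open Matrix

/-! ### Kernel vectors from vanishing maximal minors -/

section Kernel

variable {K : Type*} [Field K] {m n : Type*} [Fintype m] [Fintype n]

omit [Fintype m] in
/-- A matrix whose rank is smaller than its number of columns has a non-zero kernel vector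
(rank–nullity). [folklore] -/
theorem exists_mulVec_eq_zero_of_rank_lt_card (M : Matrix m n K) (h : M.rank < Fintype.card n) :
    ∃ w : n → K, w ≠ 0 ∧ M *ᵥ w = 0 := by
  have hrn := LinearMap.finrank_range_add_finrank_ker M.mulVecLin
  rw [Module.finrank_fintype_fun_eq_card] at hrn
  have hker : 0 < Module.finrank K (LinearMap.ker M.mulVecLin) := by
    unfold Matrix.rank at h
    omega
  obtain ⟨⟨w, hw⟩, hw0⟩ :=
    (Module.finrank_pos_iff_exists_ne_zero (R := K) (M := LinearMap.ker M.mulVecLin)).1 hker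
  refine ⟨w, fun h0 => hw0 (Subtype.ext h0), ?_⟩
  simpa using hw

/-- **Rank through maximal minors.** Over a field, if every column-full minor
`det (M.submatrix f id)` (`f : n → m`) of `M ∈ K^{m × n}` vanishes, then the columns of `M` are
linearly dependent: `M w = 0` for some `w ≠ 0`. (If `n` is empty the hypothesis is contradictory,
the empty determinant being `1`.) [folklore] -/
theorem exists_mulVec_eq_zero_of_forall_det_submatrix_eq_zero [DecidableEq n] (M : Matrix m n K)
    (h : ∀ f : n → m, (M.submatrix f id).det = 0) : ∃ w : n → K, w ≠ 0 ∧ M *ᵥ w = 0 := by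
  classical
  rcases Nat.eq_zero_or_pos (Fintype.card n) with h0 | hpos
  · -- `n` empty: the `0 × 0` minor is `1`
    haveI : IsEmpty n := Fintype.card_eq_zero_iff.1 h0
    exfalso
    have h1 := h (fun x => isEmptyElim x)
    rw [Matrix.det_isEmpty] at h1
    exact one_ne_zero h1
  · refine exists_mulVec_eq_zero_of_rank_lt_card M ?_
    obtain ⟨r, hr⟩ : ∃ r, Fintype.card n = r + 1 := ⟨Fintype.card n - 1, by omega⟩
    have hle : M.rank ≤ r := by
      refine Literature.Barriers.Schanuel.rank_le_of_det_submatrix_eq_zero M fun f g => ?_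
      by_cases hg : Function.Injective g
      · have hbij : Function.Bijective g := by
          rw [Fintype.bijective_iff_injective_and_card, Fintype.card_fin]
          exact ⟨hg, hr.symm⟩
        set e : Fin (r + 1) ≃ n := Equiv.ofBijective g hbij with he
        have hsub : M.submatrix f g = (M.submatrix (f ∘ e.symm) id).submatrix e e := by
          ext i j
          simp [he]
        rw [hsub, Matrix.det_submatrix_equiv_self]
        exact h _
      · obtain ⟨i, j, hij, hne⟩ := Function.not_injective_iff.1 hg
        exact Matrix.det_zero_of_column_eq hne fun k => by simp [hij]
    omega

end Kernel

/-! ### Integer Cramer rule with a height bound -/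

section IntCramer

variable {ρ κ : Type*} [Fintype ρ] [Fintype κ]

omit [Fintype ρ] in
/-- A solution of `M y = b` over `ℚ` of minimal support has linearly independent support
columns. [folklore] -/
theorem exists_solution_linearIndependent_cols (M : Matrix ρ κ ℚ) (b : ρ → ℚ) (y : κ → ℚ)
    (hy : M *ᵥ y = b) :
    ∃ y' : κ → ℚ, M *ᵥ y' = b ∧
      LinearIndependent ℚ (fun j : {j // y' j ≠ 0} => fun i => M i j) := by
  classical
  have hex : ∃ s, ∃ y' : κ → ℚ, M *ᵥ y' = b ∧ (Finset.univ.filter fun j => y' j ≠ 0).card = s :=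
    ⟨_, y, hy, rfl⟩
  obtain ⟨y₀, hy₀, hcard⟩ := Nat.find_spec hex
  refine ⟨y₀, hy₀, ?_⟩
  by_contra hdep
  rw [Fintype.not_linearIndependent_iff] at hdep
  obtain ⟨lam, hsum, ⟨j₁, hj₁⟩⟩ := hdep
  -- extend `lam` by zero; it is a kernel vector of `M`
  let lam' : κ → ℚ := fun j => if hj : y₀ j ≠ 0 then lam ⟨j, hj⟩ else 0
  have hlam' : M *ᵥ lam' = 0 := by
    ext i
    have hi : (∑ x : {j // y₀ j ≠ 0}, lam x * M i x : ℚ) = 0 := by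
      have := congr_fun hsum i
      simpa [Finset.sum_apply] using this
    rw [Matrix.mulVec, dotProduct, Pi.zero_apply,
      ← Fintype.sum_subtype_add_sum_subtype (fun j => y₀ j ≠ 0) (fun j => M i j * lam' j)]
    have h2 : ∑ a : {j // ¬ (y₀ j ≠ 0)}, M i a * lam' a = 0 :=
      Finset.sum_eq_zero fun a _ => by simp [lam', a.2]
    rw [h2, add_zero]
    refine Eq.trans (Finset.sum_congr rfl fun x _ => ?_) hi
    simp [lam', x.2, mul_comm]
  -- subtract a multiple killing the coordinate `j₁`: smaller support, contradiction
  set t : ℚ := y₀ j₁ / lam j₁ with ht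
  let y₁ : κ → ℚ := y₀ - t • lam'
  have hy₁ : M *ᵥ y₁ = b := by
    simp only [y₁, Matrix.mulVec_sub, Matrix.mulVec_smul, hlam', smul_zero, sub_zero, hy₀]
  have hsupp : (Finset.univ.filter fun j => y₁ j ≠ 0) ⊂ Finset.univ.filter fun j => y₀ j ≠ 0 := by
    rw [Finset.ssubset_iff_subset_ne]
    refine ⟨fun j hj => ?_, fun heq => ?_⟩
    · rw [Finset.mem_filter] at hj ⊢
      refine ⟨hj.1, fun h0 => hj.2 ?_⟩
      simp [y₁, lam', h0]
    · have hmem : (j₁ : κ) ∈ Finset.univ.filter fun j => y₀ j ≠ 0 := by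
        simpa using j₁.2
      rw [← heq, Finset.mem_filter] at hmem
      apply hmem.2
      have hj1 : lam' j₁ = lam j₁ := by simp [lam', j₁.2]
      simp only [y₁, Pi.sub_apply, Pi.smul_apply, smul_eq_mul, hj1, ht]
      field_simp
      ring
  have hlt := Finset.card_lt_card hsupp
  rw [hcard] at hlt
  exact Nat.find_min hex hlt ⟨y₁, hy₁, rfl⟩

/-- **Integer Cramer rule with a height bound.** Let `M ∈ ℤ^{ρ × κ}` and `b ∈ ℤ^ρ` have entries of
absolute value `≤ A`, `A ≥ 1`, and suppose `M y = b` has a solution `y ∈ ℚ^κ`. Then there are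
`z ∈ ℤ^κ` and an integer `Γ` with `0 < |Γ| ≤ (#κ)! · A^{#κ}` and `M z = Γ b`. [folklore] -/
theorem exists_int_mulVec_eq_smul (M : Matrix ρ κ ℤ) (b : ρ → ℤ) (A : ℕ) (hA : 1 ≤ A)
    (hM : ∀ i j, (M i j).natAbs ≤ A) (y : κ → ℚ)
    (hy : M.map (Int.cast : ℤ → ℚ) *ᵥ y = fun i => (b i : ℚ)) :
    ∃ (z : κ → ℤ) (Γ : ℤ), Γ ≠ 0 ∧
      Γ.natAbs ≤ (Fintype.card κ).factorial * A ^ Fintype.card κ ∧ M *ᵥ z = Γ • b := by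
  classical
  set MQ : Matrix ρ κ ℚ := M.map (Int.cast : ℤ → ℚ) with hMQ
  obtain ⟨y₀, hy₀, hli⟩ := exists_solution_linearIndependent_cols MQ _ y hy
  set t := Fintype.card {j : κ // y₀ j ≠ 0} with htdef
  -- the support columns, a matrix with linearly independent columns
  set N : Matrix ρ {j : κ // y₀ j ≠ 0} ℚ := MQ.submatrix id Subtype.val with hN
  have hrank : N.rank = t := by
    have hrows : LinearIndependent ℚ Nᵀ.row := hli
    rw [← Matrix.rank_transpose, hrows.rank_matrix]
  rcases Nat.eq_zero_or_pos t with ht0 | htpos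
  · -- empty support: `y₀ = 0`, so `b = 0`
    haveI : IsEmpty {j : κ // y₀ j ≠ 0} := Fintype.card_eq_zero_iff.1 ht0
    have hy00 : y₀ = 0 := by
      ext j
      by_contra hj
      exact IsEmpty.false (⟨j, hj⟩ : {j : κ // y₀ j ≠ 0})
    have hb0 : b = 0 := by
      ext i
      have := congr_fun hy₀ i
      rw [hy00, Matrix.mulVec_zero] at this
      simp only [Pi.zero_apply] at this ⊢
      exact_mod_cast this.symm
    refine ⟨0, 1, one_ne_zero, ?_, by simp [hb0]⟩
    simpa using Nat.one_le_iff_ne_zero.mpr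
      (Nat.mul_ne_zero (Nat.factorial_ne_zero _) (pow_ne_zero _ (by omega)))
  · -- a non-zero maximal minor of `N`
    obtain ⟨r, hr⟩ : ∃ r, t = r + 1 := ⟨t - 1, by omega⟩
    have hex : ∃ (f : Fin (r + 1) → ρ) (g : Fin (r + 1) → {j : κ // y₀ j ≠ 0}),
        (N.submatrix f g).det ≠ 0 := by
      by_contra! hall
      have := Literature.Barriers.Schanuel.rank_le_of_det_submatrix_eq_zero N hall
      omega
    obtain ⟨f, g, hdet⟩ := hex
    have hg : Function.Injective g := by
      intro i j hij
      by_contra hne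
      exact hdet (Matrix.det_zero_of_column_eq hne fun k => by simp [hij])
    have hgbij : Function.Bijective g := by
      rw [Fintype.bijective_iff_injective_and_card, Fintype.card_fin]
      exact ⟨hg, by rw [← htdef, hr]⟩
    set e : Fin (r + 1) ≃ {j : κ // y₀ j ≠ 0} := Equiv.ofBijective g hgbij with he
    -- the square integer block and Cramer's rule
    set BZ : Matrix (Fin (r + 1)) (Fin (r + 1)) ℤ := M.submatrix f (Subtype.val ∘ g) with hBZ
    set B : Matrix (Fin (r + 1)) (Fin (r + 1)) ℚ := N.submatrix f g with hB
    have hBmap : B = BZ.map (Int.cast : ℤ → ℚ) := by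
      ext i j
      simp [hB, hBZ, hN, hMQ]
    set u : Fin (r + 1) → ℚ := fun i => y₀ (g i) with hu
    have hBu : B *ᵥ u = fun i => (b (f i) : ℚ) := by
      ext i
      have hrow := congr_fun hy₀ (f i)
      rw [Matrix.mulVec, dotProduct] at hrow
      rw [Matrix.mulVec, dotProduct, ← hrow,
        ← Fintype.sum_subtype_add_sum_subtype (fun j => y₀ j ≠ 0) (fun j => MQ (f i) j * y₀ j)]
      have h2 : ∑ a : {j // ¬ (y₀ j ≠ 0)}, MQ (f i) a * y₀ a = 0 :=
        Finset.sum_eq_zero fun a _ => by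
          have ha : y₀ a = 0 := by simpa using a.2
          simp [ha]
      rw [h2, add_zero, ← Equiv.sum_comp e (fun a : {j // y₀ j ≠ 0} => MQ (f i) a * y₀ a)]
      rfl
    have hBunit : IsUnit B := (Matrix.isUnit_iff_isUnit_det _).2 (isUnit_iff_ne_zero.2 hdet)
    have hcramer : B.det • u = B.cramer (fun i => (b (f i) : ℚ)) := by
      apply Matrix.mulVec_injective_iff_isUnit.2 hBunit
      change B *ᵥ (B.det • u) = B *ᵥ (B.cramer fun i => (b (f i) : ℚ))
      rw [Matrix.mulVec_smul, hBu, Matrix.mulVec_cramer]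
    -- integrality of `Γ y₀`
    set Γ : ℤ := BZ.det with hΓ
    have hΓQ : (Γ : ℚ) = B.det := by
      rw [hBmap, hΓ]
      change (Int.castRingHom ℚ) BZ.det = _
      rw [RingHom.map_det, RingHom.mapMatrix_apply]
      simp only [Int.coe_castRingHom]
    set z' : Fin (r + 1) → ℤ := fun i => (BZ.updateCol i fun k => b (f k)).det with hz'
    have hz'Q : ∀ i, (z' i : ℚ) = B.det * u i := by
      intro i
      have hi := congr_fun hcramer i
      rw [Pi.smul_apply, smul_eq_mul] at hi
      rw [hi, Matrix.cramer_apply, hBmap, hz']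
      change (Int.castRingHom ℚ) (BZ.updateCol i fun k => b (f k)).det = _
      rw [RingHom.map_det, RingHom.mapMatrix_apply, Matrix.map_updateCol]
      simp only [Int.coe_castRingHom]
      rfl
    let z : κ → ℤ := fun j => if hj : y₀ j ≠ 0 then z' (e.symm ⟨j, hj⟩) else 0
    have hz : ∀ j, (z j : ℚ) = (Γ : ℚ) * y₀ j := by
      intro j
      by_cases hj : y₀ j ≠ 0
      · simp only [z, hj, dif_pos, hz'Q, hΓQ, ne_eq, not_false_eq_true]
        congr 1
        change y₀ (g (e.symm ⟨j, hj⟩)) = y₀ j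
        have h1 : (e (e.symm ⟨j, hj⟩) : κ) = j := by rw [Equiv.apply_symm_apply]
        conv_rhs => rw [← h1]
        rfl
      · push Not at hj
        simp [z, hj]
    refine ⟨z, Γ, ?_, ?_, ?_⟩
    · intro h0
      apply hdet
      rw [← hΓQ, h0, Int.cast_zero]
    · -- the trivial bound on the square integer block
      have hle := Matrix.det_le (A := BZ) (abv := AbsoluteValue.abs) (x := (A : ℤ)) fun i j => by
        rw [AbsoluteValue.abs_apply, Int.abs_eq_natAbs]
        exact_mod_cast hM (f i) (g j : κ)
      rw [AbsoluteValue.abs_apply, Int.abs_eq_natAbs, Fintype.card_fin, nsmul_eq_mul] at hle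
      have hle' : Γ.natAbs ≤ (r + 1).factorial * A ^ (r + 1) := by exact_mod_cast hle
      refine hle'.trans ?_
      have htk : r + 1 ≤ Fintype.card κ := by
        rw [← hr, htdef]
        exact Fintype.card_subtype_le _
      exact Nat.mul_le_mul (Nat.factorial_le htk) (Nat.pow_le_pow_right hA htk)
    · -- `M z = Γ b`, checked in `ℚ`
      ext i
      have hrow := congr_fun hy₀ i
      apply (Int.cast_injective (α := ℚ))
      rw [Matrix.mulVec, dotProduct] at hrow ⊢
      push_cast
      simp only [hz, Pi.smul_apply, smul_eq_mul, Int.cast_mul]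
      rw [← hrow, Finset.mul_sum]
      refine Finset.sum_congr rfl fun j _ => ?_
      simp only [hMQ, Matrix.map_apply]
      ring

end IntCramer

end Literature.RingTheory.MvPolynomial
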